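import Summits.CriticalPhenomena.PercolationContinuityZ3.Theorems.PercNearOneGluingNoHeavyLowerTailSahiSunflowerRowClosedForm
import Summits.CriticalPhenomena.PercolationContinuityZ3.Theorems.PercNearOneGluingNoHeavyLowerTailSahiSunflowerTransfer
import Summits.CriticalPhenomena.PercolationContinuityZ3.Theorems.PercNearOneGluingNoHeavyLowerTailSahiSunflowerTowerPercolation
import HarnessLib

/-!
# `NoHeavyLowerTail` (crux stmt-CriticalPhenomena-4575), master-family line P2 (Sahi's algebraic route):
# THE SUNFLOWER HIERARCHY THEOREM FOR EVERY `m` — on `Sun m` Sahi positivity of every order ⟺ the single top row; in percolation: the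
# `m`-point all-but-one-joined algebra satisfies Sahi's conjecture of every order ⟺ `mPT-LB`

Support file (seat `prim-masterthm-p2`, gen 4; `--supports stmt-CriticalPhenomena-4575`); no definition, no named fact, no sorry.  Memo SAHI-ROUTE.md §4.13.

**THEOREM (`Sun.sahiPositive_iff_row`, every `m`, every probability weight `ν` on the sunflower poset `Sun m`).**
`(∀ n, SahiPositive ν n) ⟺ 0 ≤ E_m(χ_{U([m]∖0)}, …, χ_{U([m]∖(m−1))})` — the whole Sahi hierarchy of the `m`-petal sunflower algebra is its single
top row (the complements of the members).  This is the `k`-uniform statement the cell had as CONJECTURE S_m (memo §4.10(c); `m = 3` gen 1, `m = 4`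
gen 2/3, `m = 5` gen 3 by kernel-replayed domination certificates, `m ≤ 8` by exact certificates); it is now a theorem for all `m`, with a
certificate-free proof: the engine `sahiPositive_of_hereditary` (petal-transfer induction, `…SahiSunflowerTransfer`) applied to the class
`{E_m(row) ≥ 0}`, which is hereditary under the merge maps by the closed form `E_m(row) = J_m(a; c)` (`…SahiSunflowerRowClosedForm`,
`rowJ_le_update_zero`, `rowJ_le_merge`).  In closed form (`sahiPositive_iff_rowJ`): all orders ⟺ `J_m(ν core; ν(pet ·)) ≥ 0`, i.e.
`a(a+1)⋯(a+m−2)·b ≥ Σ_{k≥2} (a+k−1)⋯(a+m−2)·e_k(c)`.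

**PERCOLATION (`Sun.sahiPositive_pat_iff_row`, every `m ≥ 3`, every finite weighted graph, every `t : Fin m → V`).**  Sahi positivity of EVERY
order of the `m`-point all-but-one-joined pattern weight (⟺ `E_n ≥ 0` for every family of nonnegative decreasing pattern-measurable functions)
⟺ the single row `mPT-LB`: `0 ≤ E_m(1_{(allBut t i)ᶜ} : i)` under the percolation weight.  Hence `allButOneRow_iff_allOrders`: for each `m ≥ 3`
the open row "`mPT-LB` on all graphs" (`m = 3`: `3PT-LB`, THEOREM; `m = 4`: `FourPointLBRow`; `m = 5`: `FivePointLBRow`; OPEN for `m ≥ 4`) is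
EQUIVALENT to Sahi's conjecture of every order on every `m`-point all-but-one-joined algebra, and follows from Sahi's `C_m`
(`allButOneRow_of_sahiConjecture`).
-/

namespace Summit.CriticalPhenomena.PercolationContinuityZ3.Theorems.SahiDeltaSystem

open Finset Function MeasureTheory Literature.Combinatorics.Sahi2008
open Literature.Probability.Percolation
open Literature.Probability.Percolation.DecisionTree (ind ind_nonneg)

namespace Sun

variable {m : ℕ}

/-- **THE SUNFLOWER HIERARCHY THEOREM (every `m`).**  For every probability weight on `Sun m`: Sahi positivity of EVERY order ⟺ the single top
row `E_m(χ_{U([m]∖i)} : i < m) ≥ 0`. [this work] -/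
theorem sahiPositive_iff_row {ν : Sun m → ℝ} (hν0 : ∀ y, 0 ≤ ν y) (hν1 : ∑ y, ν y = 1) :
    (∀ n, SahiPositive ν n) ↔ 0 ≤ sahiE ν m (fun i => setInd (U (univ.erase i))) := by
  constructor
  · intro h
    exact (sahiPositive_iff_indicators ν m).1 (h m) (fun i => U (univ.erase i)) fun i => isUpperSet_U _
  · intro hrow n
    exact sahiPositive_of_hereditary (fun ν' => 0 ≤ sahiE ν' m (fun i => setInd (U (univ.erase i))))
      (fun ν' j h0 h1 hG => row_pushWeight_merge_out_nonneg h0 h1 j hG)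
      (fun ν' j x hxj h0 h1 hG => row_pushWeight_merge_pet_nonneg h0 h1 hxj hG)
      (fun ν' _ _ hG => hG) hν0 hν1 hrow n

/-- **The row implies every order.** [this work] -/
theorem sahiPositive_of_row {ν : Sun m → ℝ} (hν0 : ∀ y, 0 ≤ ν y) (hν1 : ∑ y, ν y = 1)
    (hrow : 0 ≤ sahiE ν m (fun i => setInd (U (univ.erase i)))) (n : ℕ) : SahiPositive ν n :=
  (sahiPositive_iff_row hν0 hν1).2 hrow n

/-- **The row implies every family of up-sets**: `E_n(χ_{W_0},…,χ_{W_{n−1}}) ≥ 0` for all up-sets `W_i` of `Sun m`, all `n`. [this work] -/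
theorem sahiE_setInd_nonneg_of_row {ν : Sun m → ℝ} (hν0 : ∀ y, 0 ≤ ν y) (hν1 : ∑ y, ν y = 1)
    (hrow : 0 ≤ sahiE ν m (fun i => setInd (U (univ.erase i)))) {n : ℕ} (W : Fin n → Finset (Sun m))
    (hW : ∀ i, IsUpperSet ((W i : Finset (Sun m)) : Set (Sun m))) : 0 ≤ sahiE ν n (fun i => setInd (W i)) :=
  (sahiPositive_iff_indicators ν n).1 (sahiPositive_of_row hν0 hν1 hrow n) W hW

/-- **Closed form of the hierarchy (every `m ≥ 1`)**: all orders ⟺ `J_m(ν core; ν(pet ·)) ≥ 0`, i.e.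
`a(a+1)⋯(a+m−2)·b ≥ Σ_{k≥2}(a+k−1)⋯(a+m−2)·e_k(c)`. [this work] -/
theorem sahiPositive_iff_rowJ {ν : Sun (m + 1) → ℝ} (hν0 : ∀ y, 0 ≤ ν y) (hν1 : ∑ y, ν y = 1) :
    (∀ n, SahiPositive ν n) ↔ 0 ≤ rowJ (m + 1) (ν core) (fun i => ν (pet i)) := by
  rw [sahiPositive_iff_row hν0 hν1, row_eq_rowJ_core hν1]

/-! ## Percolation: the `m`-point all-but-one-joined algebra -/

section Percolation

variable {V : Type*} [Fintype V]

/-- **`m` points: all orders ⟺ `mPT-LB`.**  For every `m ≥ 3`, every finite weighted graph and `t : Fin m → V`: Sahi positivity of EVERY order of the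
`m`-point all-but-one-joined pattern weight ⟺ `0 ≤ E_m(1_{(allBut t i)ᶜ} : i < m)` under the percolation weight. [this work] -/
theorem sahiPositive_pat_iff_row (hm : 3 ≤ m) (w : Sym2 V → unitInterval) (t : Fin m → V) :
    (∀ n, SahiPositive (pushWeight (bernoulliWeight w) (pat t)) n) ↔ 0 ≤ sahiE (bernoulliWeight w) m (fun i => ind (allBut t i)ᶜ) := by
  rw [sahiPositive_iff_row (pushWeight_pat_nonneg w t) (sum_pushWeight_pat w t), row_pat_eq hm w t]

/-- **`mPT-LB` ⇒ every decreasing pattern family**: if `0 ≤ E_m(1_{(allBut t i)ᶜ} : i)` then `E_n(f_0 ∘ pat t, …) ≥ 0` for all `n` and all nonnegative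
`f_i` monotone on `Sun m` (= nonnegative pattern-measurable functions DECREASING in the configuration), under the percolation weight. [this work] -/
theorem sahiE_pattern_nonneg_of_row (hm : 3 ≤ m) (w : Sym2 V → unitInterval) (t : Fin m → V)
    (hrow : 0 ≤ sahiE (bernoulliWeight w) m (fun i => ind (allBut t i)ᶜ)) {n : ℕ} (f : Fin n → Sun m → ℝ)
    (hf0 : ∀ i y, 0 ≤ f i y) (hf : ∀ i, Monotone (f i)) :
    0 ≤ sahiE (bernoulliWeight w) n (fun i => f i ∘ pat t) := by
  rw [← sahiE_pushWeight]
  exact (sahiPositive_pat_iff_row hm w t).2 hrow n f hf0 hf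

end Percolation

/-- **The open row `mPT-LB` (all graphs) ⟺ Sahi's conjecture of every order on every `m`-point all-but-one-joined algebra** (`m ≥ 3`). [this work] -/
theorem allButOneRow_iff_allOrders (hm : 3 ≤ m) :
    (∀ (V : Type) [Fintype V] (w : Sym2 V → unitInterval) (t : Fin m → V), 0 ≤ sahiE (bernoulliWeight w) m (fun i => ind (allBut t i)ᶜ)) ↔
      ∀ (V : Type) [Fintype V] (w : Sym2 V → unitInterval) (t : Fin m → V) (n : ℕ), SahiPositive (pushWeight (bernoulliWeight w) (pat t)) n :=
  ⟨fun h V _ w t n => (sahiPositive_pat_iff_row hm w t).2 (h V w t) n, fun h V _ w t => (sahiPositive_pat_iff_row hm w t).1 (h V w t)⟩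

/-- **Sahi's `C_m` ⇒ `mPT-LB`** on every finite weighted graph (the `m`-th rung of the sunflower tower is an instance of `C_m` for product measures).
[this work] -/
theorem allButOneRow_of_sahiConjecture (hC : SahiConjecture m) (V : Type) [Fintype V] (w : Sym2 V → unitInterval) (t : Fin m → V) :
    0 ≤ sahiE (bernoulliWeight w) m (fun i => ind (allBut t i)ᶜ) :=
  sahiE_ind_nonneg_of_sahiPositive_lower w (hC (Set (Sym2 V))ᵒᵈ (bernoulliWeightDual w) (isFKGMeasure_bernoulliWeightDual w))
    fun i => isLowerSet_compl_allBut t i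

end Sun
end Summit.CriticalPhenomena.PercolationContinuityZ3.Theorems.SahiDeltaSystem
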